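import Literature.Analysis.FluidPDE.NewtonNearDerivatives
import Literature.Analysis.FluidPDE.WholeSpaceIBP
import HarnessLib

/-!
# The Hessian of the near-field Newtonian kernel: Hörmander regularity and the cancellation
bound by smooth truncation

Analysis/FluidPDE support file on the discharge path of the named fact
`Literature.Analysis.FluidPDE.MajdaBertozzi2002_holderEulerLocalExistence`
(`ElgindiBlowupContinuationProofs.lean`; Lagrangian decomposition `HolderEulerLagrangian.lean`).
For the kernels `K_{ab}(z) = ∂_b∂_aΓ₀(z) = newtonNearHess r₀ r₁ a b z` of the compactly supported
near part `Γ₀ = θΓ = newtonNear r₀ r₁` of the Newtonian kernel (`NewtonKernel.lean`,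
`NewtonNearDerivatives.lean`) this file proves the two analytic inputs of the Hölder theory of
singular integrals (Majda–Bertozzi, *Vorticity and Incompressible Flow*, CUP 2002, §4.1.3
(4.31)–(4.33) and **Lemma 4.6**, p. 129 of the held text; Gilbarg–Trudinger 2001, Lemma 4.4),
in the sphere-free form consumed by `HolderCZKernel.lean` / `NewtonNearCZ.lean`:

* `isSingularKernel_newtonNearHess`: size `|K_{ab}(z)| ≤ C₂‖a‖‖b‖|z|⁻³` and Hörmander regularity
  `|K_{ab}(x−y) − K_{ab}(z−y)| ≤ 16C₃‖a‖‖b‖|x−z||x−y|⁻⁴` for `|x−y| ≥ 2|x−z|` (mean value theorem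
  on the segment `[x−y, z−y]`, whose points have norm `≥ |x−y|/2`, with
  `‖DK_{ab}(w)‖ ≤ C₃‖a‖‖b‖|w|⁻⁴`);
* the smooth truncation `χ(z) = 1 − θ₂₃(d⁻¹(z + w))` (`θ₂₃ = radialCutoff 2 3`; `χ = 0` for
  `|z + w| ≤ 2d`, `= 1` for `|z + w| ≥ 3d`, `|∂_bχ| ≤ M_θ‖b‖/d`), the `C¹_c` function `χ ∂_aΓ₀`
  (the truncation kills a neighbourhood of the singularity when `|w| ≤ d`) and the product rule
  `∂_b(χ∂_aΓ₀) = (∂_bχ)∂_aΓ₀ + χ ∂_b∂_aΓ₀` at every point;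
* `abs_integral_truncate_newtonNearHess_le` — **the cancellation bound, by integration by
  parts**: for `d > 0`, `|w| ≤ d`, `∫ χ K_{ab} = −∫ (∂_bχ) ∂_aΓ₀` (`∫ ∂_b(χ ∂_aΓ₀) = 0`,
  `integral_fderiv_apply_eq_zero`); the right-hand side lives on the shell `2d ≤ |z + w| ≤ 3d`,
  where `|∂_bχ| ≤ M_θ‖b‖/d` and `|∂_aΓ₀(z)| ≤ C₁‖a‖/d²` (`|z| ≥ d`), inside a ball of volume
  `36πd³`: `|∫ χ K_{ab}| ≤ 36π M_θ C₁ ‖a‖‖b‖`, uniformly in `d` — the replacement of the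
  mean-zero property (4.32) of `P_N` on spheres. The same truncated kernels, with `w = 0` and
  `d = ε`, are the regularisations `∂_aΓ₀ (1 − θ₂₃(·/ε))` used to differentiate the near
  potential (`NewtonNearPotential*.lean`).

## Mathlib / tree search

Tree (all used): `newtonNearGrad`, `newtonNearHess`, `exists_abs_newtonNearGrad_le`,
`hasFDerivAt_newtonNearHess`, `fderiv_newtonNearGrad_apply`, `differentiableAt_newtonNearGrad`,
`newtonNearHess_eq_zero_of_le`, `integrable_newtonNearGrad`, `contDiffAt_newtonNearGrad`,
`hasCompactSupport_newtonNearGrad`, `measurable_newtonNearHess` (`NewtonNearDerivatives`);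
`half_norm_le_of_mem_segment`, `IsSingularKernel` (`NewtonPotentialHolder`); `radialCutoff*`
(`NewtonKernel`); `integral_fderiv_apply_eq_zero` (`WholeSpaceIBP`). Mathlib:
`Convex.norm_image_sub_le_of_norm_fderiv_le`, `Continuous.bounded_above_of_compact_support`,
`HasCompactSupport.fderiv`, `EuclideanSpace.volume_closedBall_fin_three`.

## References

* A. J. Majda, A. L. Bertozzi, *Vorticity and Incompressible Flow* (CUP 2002), §4.1.3
  (4.31)–(4.33), Lemma 4.6 (4.35)–(4.36), p. 129; proof §4.5 p. 144–145. [MajdaBertozziCUP2002]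
* D. Gilbarg, N. S. Trudinger, *Elliptic Partial Differential Equations of Second Order*
  (2001), Lemma 4.2 (the cutoff `η`), Lemma 4.4. [GilbargTrudinger2001]
-/

noncomputable section

open MeasureTheory Set Function Filter Metric Real
open _root_.Topology
open scoped NNReal ENNReal

namespace Literature.Analysis.FluidPDE

open NewtonPotentialHolder

-- nested operator types `ℝ³ →L[ℝ] ℝ³ →L[ℝ] ℝ³ →L[ℝ] ℝ` (third derivatives)
set_option maxSynthPendingDepth 3

/-- Local notation for physical space `ℝ³ = EuclideanSpace ℝ (Fin 3)`. -/
local notation "ℝ³" => EuclideanSpace ℝ (Fin 3)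

variable {r₀ r₁ : ℝ}

/-! ### Size and Hörmander regularity -/

/-- `|z|^{-4}` in inverse-power form, and the bound `|w|⁻⁴ ≤ 16|x−y|⁻⁴` for `|w| ≥ |x−y|/2`.
[folklore] -/
theorem rpow_neg_four_le_sixteen_mul {w : ℝ³} {d : ℝ} (hd : 0 < d) (hw : d / 2 ≤ ‖w‖) :
    ‖w‖ ^ (-(4 : ℝ)) ≤ 16 * d ^ (-(4 : ℝ)) := by
  have hw0 : 0 < ‖w‖ := by linarith
  have e16 : (16 : ℝ) = (2⁻¹ : ℝ) ^ (-(4 : ℝ)) := by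
    rw [Real.rpow_neg (by norm_num), Real.inv_rpow (by norm_num)]
    norm_num
  rw [e16, ← Real.mul_rpow (by norm_num) hd.le]
  exact Real.rpow_le_rpow_of_nonpos (by positivity) (by linarith) (by norm_num)

/-- **`∂_b∂_aΓ₀` is a singular kernel of degree `−3`**: `|K_{ab}(z)| ≤ C₂‖a‖‖b‖|z|⁻³` and
`|K_{ab}(x − y) − K_{ab}(z − y)| ≤ 16C₃‖a‖‖b‖|x − z||x − y|⁻⁴` for `|x − y| ≥ 2|x − z|` (mean
value theorem on the segment, all of whose points have norm `≥ |x − y|/2`). The constants are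
those of `exists_abs_newtonNearHess_le` and `exists_norm_fderiv_newtonNearHess_le`. [folklore] -/
theorem isSingularKernel_newtonNearHess (h₀ : 0 < r₀) (h₁ : r₀ < r₁) {C₂ C₃ : ℝ}
    (hC₂ : ∀ a b z : ℝ³, |newtonNearHess r₀ r₁ a b z| ≤ C₂ * ‖a‖ * ‖b‖ * ‖z‖ ^ (-(3 : ℝ)))
    (hC₃0 : 0 ≤ C₃)
    (hC₃ : ∀ a b z : ℝ³, z ≠ 0 →
      ‖fderiv ℝ (newtonNearHess r₀ r₁ a b) z‖ ≤ C₃ * ‖a‖ * ‖b‖ * ‖z‖ ^ (-(4 : ℝ)))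
    (a b : ℝ³) :
    IsSingularKernel (newtonNearHess r₀ r₁ a b) 3 (C₂ * ‖a‖ * ‖b‖) (16 * C₃ * ‖a‖ * ‖b‖) where
  measurable := measurable_newtonNearHess r₀ r₁ a b
  abs_le z := hC₂ a b z
  abs_sub_le x z y hxz hy := by
    have _ := h₀.trans h₁
    have hd : 0 < ‖x - z‖ := norm_pos_iff.2 (sub_ne_zero.2 hxz)
    have hxy : 0 < ‖x - y‖ := by linarith
    set L : ℝ := 16 * C₃ * ‖a‖ * ‖b‖ * ‖x - y‖ ^ (-(4 : ℝ)) with hL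
    have hseg : ∀ w ∈ segment ℝ (x - y) (z - y), ‖x - y‖ / 2 ≤ ‖w‖ := fun w hw =>
      half_norm_le_of_mem_segment hy hw
    have hne : ∀ w ∈ segment ℝ (x - y) (z - y), w ≠ 0 := fun w hw => by
      have := hseg w hw
      rw [← norm_pos_iff]; linarith
    have hdiff : ∀ w ∈ segment ℝ (x - y) (z - y),
        DifferentiableAt ℝ (newtonNearHess r₀ r₁ a b) w := fun w hw =>
      (hasFDerivAt_newtonNearHess r₀ r₁ a b (hne w hw)).differentiableAt
    have hbound : ∀ w ∈ segment ℝ (x - y) (z - y),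
        ‖fderiv ℝ (newtonNearHess r₀ r₁ a b) w‖ ≤ L := by
      intro w hw
      refine (hC₃ a b w (hne w hw)).trans ?_
      rw [hL]
      have h16 := rpow_neg_four_le_sixteen_mul hxy (hseg w hw)
      have hc : 0 ≤ C₃ * ‖a‖ * ‖b‖ := by positivity
      calc C₃ * ‖a‖ * ‖b‖ * ‖w‖ ^ (-(4 : ℝ)) ≤ C₃ * ‖a‖ * ‖b‖ * (16 * ‖x - y‖ ^ (-(4 : ℝ))) :=
            mul_le_mul_of_nonneg_left h16 hc
        _ = 16 * C₃ * ‖a‖ * ‖b‖ * ‖x - y‖ ^ (-(4 : ℝ)) := by ring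
    have hmv := (convex_segment (x - y) (z - y)).norm_image_sub_le_of_norm_fderiv_le hdiff hbound
      (right_mem_segment ℝ (x - y) (z - y)) (left_mem_segment ℝ (x - y) (z - y))
    rw [show x - y - (z - y) = x - z by abel] at hmv
    rw [← Real.norm_eq_abs]
    refine hmv.trans (le_of_eq ?_)
    rw [hL, show (-(3 + 1) : ℝ) = -4 by norm_num]
    ring

/-! ### The smooth truncation `χ(z) = 1 − θ₂₃(d⁻¹(z + w))` -/

/-- **The derivative of the fixed cutoff `θ₂₃ = radialCutoff 2 3` is bounded** (smooth with
compact support). [folklore] -/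
theorem exists_norm_fderiv_radialCutoff_two_three_le :
    ∃ M, 0 ≤ M ∧ ∀ u : ℝ³, ‖fderiv ℝ (radialCutoff 2 3 : ℝ³ → ℝ) u‖ ≤ M := by
  have hc : ContDiff ℝ 1 (radialCutoff 2 3 : ℝ³ → ℝ) := radialCutoff_contDiff 2 3
  have hcs : HasCompactSupport (radialCutoff 2 3 : ℝ³ → ℝ) :=
    hasCompactSupport_radialCutoff (by norm_num) (by norm_num)
  obtain ⟨M, hM⟩ := (hc.continuous_fderiv one_ne_zero).bounded_above_of_compact_support (hcs.fderiv (𝕜 := ℝ))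
  exact ⟨max M 0, le_max_right _ _, fun u => (hM u).trans (le_max_left _ _)⟩

section Truncation

variable {w : ℝ³} {d : ℝ}

/-- The truncation `χ(z) = 1 − θ₂₃(d⁻¹(z + w))` is smooth. [folklore] -/
theorem contDiff_truncation (w : ℝ³) (d : ℝ) {n : ℕ∞} :
    ContDiff ℝ n fun z : ℝ³ => 1 - radialCutoff 2 3 (d⁻¹ • (z + w)) :=
  contDiff_const.sub ((radialCutoff_contDiff (E' := ℝ³) 2 3 (n := n)).comp
    ((contDiff_id.add contDiff_const).const_smul _))

/-- `0 ≤ χ ≤ 1`, in the form `|χ| ≤ 1`. [folklore] -/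
theorem abs_truncation_le_one (w : ℝ³) (d : ℝ) (z : ℝ³) :
    |1 - radialCutoff 2 3 (d⁻¹ • (z + w))| ≤ 1 := by
  have h0 := radialCutoff_nonneg 2 3 (d⁻¹ • (z + w))
  have h1 := radialCutoff_le_one 2 3 (d⁻¹ • (z + w))
  rw [abs_le]; constructor <;> linarith

/-- The rescaled variable: `‖d⁻¹(z + w)‖ = d⁻¹‖z + w‖` for `d > 0`. [folklore] -/
theorem norm_smul_add_eq (hd : 0 < d) (z : ℝ³) : ‖d⁻¹ • (z + w)‖ = d⁻¹ * ‖z + w‖ := by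
  rw [norm_smul, norm_inv, Real.norm_eq_abs, abs_of_pos hd]

/-- **`χ = 0` near every point with `|z + w| < 2d`** (there `θ₂₃ = 1`). [folklore] -/
theorem truncation_eventuallyEq_zero (hd : 0 < d) {z : ℝ³} (hz : ‖z + w‖ < 2 * d) :
    (fun z : ℝ³ => 1 - radialCutoff 2 3 (d⁻¹ • (z + w))) =ᶠ[𝓝 z] fun _ => (0 : ℝ) := by
  have hopen : IsOpen {v : ℝ³ | ‖v + w‖ < 2 * d} :=
    isOpen_lt (continuous_id.add continuous_const).norm continuous_const
  filter_upwards [hopen.mem_nhds hz] with v hv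
  rw [radialCutoff_eq_one (by norm_num) (by norm_num), sub_self]
  rw [norm_smul_add_eq hd, inv_mul_le_iff₀ hd]
  exact (le_of_lt hv).trans (le_of_eq (by ring))

/-- **`χ = 1` near every point with `|z + w| > 3d`** (there `θ₂₃ = 0`). [folklore] -/
theorem truncation_eventuallyEq_one (hd : 0 < d) {z : ℝ³} (hz : 3 * d < ‖z + w‖) :
    (fun z : ℝ³ => 1 - radialCutoff 2 3 (d⁻¹ • (z + w))) =ᶠ[𝓝 z] fun _ => (1 : ℝ) := by
  have hopen : IsOpen {v : ℝ³ | 3 * d < ‖v + w‖} :=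
    isOpen_lt continuous_const (continuous_id.add continuous_const).norm
  filter_upwards [hopen.mem_nhds hz] with v hv
  rw [radialCutoff_eq_zero (by norm_num) (by norm_num), sub_zero]
  rw [norm_smul_add_eq hd, le_inv_mul_iff₀ hd]
  linarith

/-- `χ = 0` near the origin when `|w| ≤ d`. [folklore] -/
theorem truncation_eventuallyEq_zero_origin (hd : 0 < d) (hw : ‖w‖ ≤ d) :
    (fun z : ℝ³ => 1 - radialCutoff 2 3 (d⁻¹ • (z + w))) =ᶠ[𝓝 0] fun _ => (0 : ℝ) :=
  truncation_eventuallyEq_zero hd (by rw [zero_add]; linarith)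

/-- **Chain rule for `χ`**: `Dχ(z) = −Dθ₂₃(d⁻¹(z + w)) ∘ (d⁻¹ I)`. [folklore] -/
theorem hasFDerivAt_truncation (d : ℝ) (w z : ℝ³) :
    HasFDerivAt (fun z : ℝ³ => 1 - radialCutoff 2 3 (d⁻¹ • (z + w)))
      (-((fderiv ℝ (radialCutoff 2 3 : ℝ³ → ℝ) (d⁻¹ • (z + w))).comp
        (d⁻¹ • ContinuousLinearMap.id ℝ ℝ³))) z := by
  have hu : HasFDerivAt (fun z : ℝ³ => d⁻¹ • (z + w)) (d⁻¹ • ContinuousLinearMap.id ℝ ℝ³) z :=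
    ((hasFDerivAt_id z).add_const w).const_smul d⁻¹
  have hθ : HasFDerivAt (radialCutoff 2 3 : ℝ³ → ℝ)
      (fderiv ℝ (radialCutoff 2 3 : ℝ³ → ℝ) (d⁻¹ • (z + w))) (d⁻¹ • (z + w)) :=
    ((radialCutoff_contDiff (E' := ℝ³) 2 3 (n := 1)).differentiable one_ne_zero _).hasFDerivAt
  have h := (hasFDerivAt_const (1 : ℝ) z).sub (hθ.comp z hu)
  rwa [zero_sub] at h

/-- **Bound for `∂_bχ`**: `|Dχ(z) b| ≤ M_θ d⁻¹ ‖b‖`. [folklore] -/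
theorem abs_fderiv_truncation_le (hd : 0 < d) {M : ℝ}
    (hM : ∀ u : ℝ³, ‖fderiv ℝ (radialCutoff 2 3 : ℝ³ → ℝ) u‖ ≤ M) (z b : ℝ³) :
    |fderiv ℝ (fun z : ℝ³ => 1 - radialCutoff 2 3 (d⁻¹ • (z + w))) z b| ≤ M * d⁻¹ * ‖b‖ := by
  rw [(hasFDerivAt_truncation d w z).fderiv, neg_apply, abs_neg,
    ContinuousLinearMap.comp_apply, smul_apply, ContinuousLinearMap.id_apply,
    ← Real.norm_eq_abs]
  calc ‖fderiv ℝ (radialCutoff 2 3 : ℝ³ → ℝ) (d⁻¹ • (z + w)) (d⁻¹ • b)‖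
      ≤ ‖fderiv ℝ (radialCutoff 2 3 : ℝ³ → ℝ) (d⁻¹ • (z + w))‖ * ‖d⁻¹ • b‖ :=
        ContinuousLinearMap.le_opNorm _ _
    _ ≤ M * ‖d⁻¹ • b‖ := mul_le_mul_of_nonneg_right (hM _) (norm_nonneg _)
    _ = M * d⁻¹ * ‖b‖ := by
        rw [norm_smul, norm_inv, Real.norm_eq_abs, abs_of_pos hd, mul_assoc]

/-- `∂_bχ(z) = 0` unless `2d ≤ |z + w| ≤ 3d`. [folklore] -/
theorem fderiv_truncation_eq_zero (hd : 0 < d) {z : ℝ³}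
    (hz : ‖z + w‖ < 2 * d ∨ 3 * d < ‖z + w‖) :
    fderiv ℝ (fun z : ℝ³ => 1 - radialCutoff 2 3 (d⁻¹ • (z + w))) z = 0 := by
  rcases hz with hz | hz
  · rw [(truncation_eventuallyEq_zero hd hz).fderiv_eq, fderiv_const_apply]
  · rw [(truncation_eventuallyEq_one hd hz).fderiv_eq, fderiv_const_apply]

end Truncation

/-! ### The cancellation bound by integration by parts -/

section Cancellation

variable {w : ℝ³} {d : ℝ}

/-- **`χ ∂_aΓ₀` is `C¹` on all of `ℝ³`**: off the origin both factors are smooth; near the origin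
the product vanishes identically (`χ = 0` there since `|w| ≤ d < 2d`). [folklore] -/
theorem contDiff_truncation_mul_newtonNearGrad (h₀ : 0 < r₀) (h₁ : r₀ < r₁) (hd : 0 < d)
    (hw : ‖w‖ ≤ d) (a : ℝ³) :
    ContDiff ℝ 1 fun z : ℝ³ =>
      (1 - radialCutoff 2 3 (d⁻¹ • (z + w))) * newtonNearGrad r₀ r₁ a z := by
  have _ := h₀.trans h₁
  refine contDiff_iff_contDiffAt.2 fun z => ?_
  by_cases hz : z = 0
  · subst hz
    refine (contDiffAt_const (c := (0 : ℝ))).congr_of_eventuallyEq ?_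
    filter_upwards [truncation_eventuallyEq_zero_origin hd hw] with v hv
    rw [hv, zero_mul]
  · exact (contDiff_truncation w d (n := 1)).contDiffAt.mul
      (contDiffAt_newtonNearGrad r₀ r₁ a hz)

/-- `χ ∂_aΓ₀` has compact support (that of `∂_aΓ₀`). [folklore] -/
theorem hasCompactSupport_truncation_mul_newtonNearGrad (h₀ : 0 < r₀) (h₁ : r₀ < r₁)
    (w : ℝ³) (d : ℝ) (a : ℝ³) :
    HasCompactSupport fun z : ℝ³ =>
      (1 - radialCutoff 2 3 (d⁻¹ • (z + w))) * newtonNearGrad r₀ r₁ a z :=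
  (hasCompactSupport_newtonNearGrad h₀ h₁ a).mul_left

/-- **Product rule for `∂_b(χ ∂_aΓ₀)`**, valid at every point:
`∂_b(χ ∂_aΓ₀)(z) = ∂_bχ(z) ∂_aΓ₀(z) + χ(z) ∂_b∂_aΓ₀(z)` (off the origin by the product rule; at
the origin every term vanishes, `χ` being `0` nearby). [folklore] -/
theorem fderiv_truncation_mul_newtonNearGrad_apply (hd : 0 < d) (hw : ‖w‖ ≤ d) (a b z : ℝ³) :
    fderiv ℝ (fun z : ℝ³ =>
        (1 - radialCutoff 2 3 (d⁻¹ • (z + w))) * newtonNearGrad r₀ r₁ a z) z b =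
      fderiv ℝ (fun z : ℝ³ => 1 - radialCutoff 2 3 (d⁻¹ • (z + w))) z b *
          newtonNearGrad r₀ r₁ a z +
        (1 - radialCutoff 2 3 (d⁻¹ • (z + w))) * newtonNearHess r₀ r₁ a b z := by
  by_cases hz : z = 0
  · subst hz
    have h1 : fderiv ℝ (fun z : ℝ³ =>
        (1 - radialCutoff 2 3 (d⁻¹ • (z + w))) * newtonNearGrad r₀ r₁ a z) 0 = 0 := by
      have hev : (fun z : ℝ³ =>
          (1 - radialCutoff 2 3 (d⁻¹ • (z + w))) * newtonNearGrad r₀ r₁ a z) =ᶠ[𝓝 0]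
          fun _ => (0 : ℝ) := by
        filter_upwards [truncation_eventuallyEq_zero_origin hd hw] with v hv
        rw [hv, zero_mul]
      rw [hev.fderiv_eq, fderiv_const_apply]
    have h2 : fderiv ℝ (fun z : ℝ³ => 1 - radialCutoff 2 3 (d⁻¹ • (z + w))) 0 = 0 :=
      fderiv_truncation_eq_zero hd (Or.inl (by rw [zero_add]; linarith))
    have h3 : (1 : ℝ) - radialCutoff 2 3 (d⁻¹ • ((0 : ℝ³) + w)) = 0 :=
      (truncation_eventuallyEq_zero_origin hd hw).eq_of_nhds
    rw [h1, h2, h3]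
    simp
  · have hχ : DifferentiableAt ℝ (fun z : ℝ³ => 1 - radialCutoff 2 3 (d⁻¹ • (z + w))) z :=
      (hasFDerivAt_truncation d w z).differentiableAt
    have hg : DifferentiableAt ℝ (newtonNearGrad r₀ r₁ a) z :=
      differentiableAt_newtonNearGrad r₀ r₁ a hz
    rw [fderiv_fun_mul hχ hg, add_apply, smul_apply,
      smul_apply, fderiv_newtonNearGrad_apply r₀ r₁ a b hz, smul_eq_mul,
      smul_eq_mul]
    ring

/-- On the shell where `∂_bχ ≠ 0` (so `|z + w| ≥ 2d`) and `|w| ≤ d`, one has `|z| ≥ d`, whence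
`|z|⁻² ≤ d⁻²`. [folklore] -/
theorem rpow_neg_two_le_of_shell (hd : 0 < d) (hw : ‖w‖ ≤ d) {z : ℝ³} (hz : 2 * d ≤ ‖z + w‖) :
    ‖z‖ ^ (-(2 : ℝ)) ≤ d ^ (-(2 : ℝ)) := by
  have hzd : d ≤ ‖z‖ := by
    have := norm_add_le z w
    linarith
  exact Real.rpow_le_rpow_of_nonpos hd hzd (by norm_num)

/-- **The boundary term of the integration by parts**: with `M_θ` a bound for `Dθ₂₃` and
`C₁` the constant of `|∂_aΓ₀(z)| ≤ C₁‖a‖|z|⁻²`,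
`|∫ ∂_bχ(z) ∂_aΓ₀(z) dz| ≤ 36π M_θ C₁ ‖a‖‖b‖` (the integrand lives on `|z + w| ≤ 3d`, a ball of
volume `36πd³`, and is bounded there by `M_θ d⁻¹‖b‖ · C₁‖a‖ d⁻²`). [folklore] -/
theorem abs_integral_fderiv_truncation_mul_newtonNearGrad_le (h₀ : 0 < r₀) (h₁ : r₀ < r₁)
    (hd : 0 < d) (hw : ‖w‖ ≤ d) {M C₁ : ℝ} (hM0 : 0 ≤ M)
    (hM : ∀ u : ℝ³, ‖fderiv ℝ (radialCutoff 2 3 : ℝ³ → ℝ) u‖ ≤ M) (hC₁0 : 0 ≤ C₁)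
    (hC₁ : ∀ a z : ℝ³, |newtonNearGrad r₀ r₁ a z| ≤ C₁ * ‖a‖ * ‖z‖ ^ (-(2 : ℝ))) (a b : ℝ³) :
    |∫ z, fderiv ℝ (fun z : ℝ³ => 1 - radialCutoff 2 3 (d⁻¹ • (z + w))) z b *
        newtonNearGrad r₀ r₁ a z| ≤ 36 * π * M * C₁ * ‖a‖ * ‖b‖ := by
  have _ := h₀.trans h₁
  set K : ℝ := M * d⁻¹ * ‖b‖ * (C₁ * ‖a‖ * d ^ (-(2 : ℝ))) with hK
  have hK0 : 0 ≤ K := by positivity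
  -- pointwise: the integrand is bounded by `K` on the closed ball `B̄(−w, 3d)` and vanishes off it
  have hpt : ∀ z, ‖fderiv ℝ (fun z : ℝ³ => 1 - radialCutoff 2 3 (d⁻¹ • (z + w))) z b *
      newtonNearGrad r₀ r₁ a z‖ₑ ≤ (closedBall (-w) (3 * d)).indicator (fun _ => ENNReal.ofReal K) z := by
    intro z
    by_cases hz3 : 3 * d < ‖z + w‖
    · rw [fderiv_truncation_eq_zero hd (Or.inr hz3), zero_apply, zero_mul, enorm_zero]
      exact bot_le
    rw [not_lt] at hz3
    have hmem : z ∈ closedBall (-w) (3 * d) := by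
      rw [mem_closedBall, dist_eq_norm, sub_neg_eq_add]; exact hz3
    rw [indicator_of_mem hmem, ← ofReal_norm]
    refine ENNReal.ofReal_le_ofReal ?_
    by_cases hz2 : ‖z + w‖ < 2 * d
    · rw [fderiv_truncation_eq_zero hd (Or.inl hz2), zero_apply, zero_mul,
        norm_zero]
      exact hK0
    rw [not_lt] at hz2
    rw [norm_mul, Real.norm_eq_abs, Real.norm_eq_abs, hK]
    refine mul_le_mul (abs_fderiv_truncation_le hd hM z b) ((hC₁ a z).trans ?_) (abs_nonneg _)
      (by positivity)
    exact mul_le_mul_of_nonneg_left (rpow_neg_two_le_of_shell hd hw hz2) (by positivity)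
  -- integrate
  have h1 : ‖∫ z, fderiv ℝ (fun z : ℝ³ => 1 - radialCutoff 2 3 (d⁻¹ • (z + w))) z b *
      newtonNearGrad r₀ r₁ a z‖ₑ ≤ ENNReal.ofReal (36 * π * M * C₁ * ‖a‖ * ‖b‖) := by
    calc _ ≤ ∫⁻ z, ‖fderiv ℝ (fun z : ℝ³ => 1 - radialCutoff 2 3 (d⁻¹ • (z + w))) z b *
          newtonNearGrad r₀ r₁ a z‖ₑ := enorm_integral_le_lintegral_enorm _
      _ ≤ ∫⁻ z, (closedBall (-w) (3 * d)).indicator (fun _ => ENNReal.ofReal K) z :=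
          lintegral_mono hpt
      _ = ENNReal.ofReal K * volume (closedBall (-w) (3 * d)) := by
          rw [lintegral_indicator measurableSet_closedBall, setLIntegral_const]
      _ = ENNReal.ofReal (36 * π * M * C₁ * ‖a‖ * ‖b‖) := by
          rw [EuclideanSpace.volume_closedBall_fin_three, ← ENNReal.ofReal_pow (by positivity),
            ← ENNReal.ofReal_mul (by positivity), ← ENNReal.ofReal_mul hK0]
          congr 1
          rw [hK]
          have hd0 : d ≠ 0 := hd.ne'
          rw [Real.rpow_neg hd.le, show (2 : ℝ) = ((2 : ℕ) : ℝ) by norm_num, Real.rpow_natCast]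
          field_simp
          ring
  rw [← ofReal_norm, ENNReal.ofReal_le_ofReal_iff (by positivity), Real.norm_eq_abs] at h1
  exact h1

/-- **The cancellation bound for `∂_b∂_aΓ₀`** (sphere-free replacement of the mean-zero property
(4.32) of `P_N`): for `d > 0`, `|w| ≤ d`,
`|∫ (1 − θ₂₃(d⁻¹(z + w))) ∂_b∂_aΓ₀(z) dz| ≤ 36π M_θ C₁ ‖a‖‖b‖`, by the integration by parts
`∫ χ ∂_b∂_aΓ₀ = −∫ (∂_bχ) ∂_aΓ₀` (`∫ ∂_b(χ∂_aΓ₀) = 0`, `χ∂_aΓ₀ ∈ C¹_c`). [cite: MajdaBertozziCUP2002, §4.1.3 (4.32)–(4.33) (p. 129), mean value zero of P_N] -/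
theorem abs_integral_truncate_newtonNearHess_le (h₀ : 0 < r₀) (h₁ : r₀ < r₁) (hd : 0 < d)
    (hw : ‖w‖ ≤ d) {M C₁ C₂ : ℝ} (hM0 : 0 ≤ M)
    (hM : ∀ u : ℝ³, ‖fderiv ℝ (radialCutoff 2 3 : ℝ³ → ℝ) u‖ ≤ M) (hC₁0 : 0 ≤ C₁)
    (hC₁ : ∀ a z : ℝ³, |newtonNearGrad r₀ r₁ a z| ≤ C₁ * ‖a‖ * ‖z‖ ^ (-(2 : ℝ)))
    (hC₂ : ∀ a b z : ℝ³, |newtonNearHess r₀ r₁ a b z| ≤ C₂ * ‖a‖ * ‖b‖ * ‖z‖ ^ (-(3 : ℝ)))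
    (a b : ℝ³) :
    |∫ z, (1 - radialCutoff 2 3 (d⁻¹ • (z + w))) * newtonNearHess r₀ r₁ a b z| ≤
      36 * π * M * C₁ * ‖a‖ * ‖b‖ := by
  set χ : ℝ³ → ℝ := fun z => 1 - radialCutoff 2 3 (d⁻¹ • (z + w)) with hχ
  -- the two pieces of `∂_b(χ ∂_aΓ₀)`
  set P : ℝ³ → ℝ := fun z => fderiv ℝ χ z b * newtonNearGrad r₀ r₁ a z with hP
  set Q : ℝ³ → ℝ := fun z => χ z * newtonNearHess r₀ r₁ a b z with hQ
  have hχc : Continuous χ := (contDiff_truncation w d (n := 0)).continuous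
  have hχ1 : ∀ z, |χ z| ≤ 1 := abs_truncation_le_one w d
  -- integrability of `P`: bounded derivative of `χ` times the integrable `∂_aΓ₀`
  have IP : Integrable P := by
    have hcont : Continuous fun z => fderiv ℝ χ z b :=
      ((contDiff_truncation w d (n := 1)).continuous_fderiv one_ne_zero).clm_apply continuous_const
    refine (integrable_newtonNearGrad h₀ h₁ a).bdd_mul (c := M * d⁻¹ * ‖b‖)
      hcont.aestronglyMeasurable (Eventually.of_forall fun z => ?_)
    rw [Real.norm_eq_abs]
    exact abs_fderiv_truncation_le hd hM z b
  -- integrability of `Q`: bounded (the truncation kills the singularity) with compact support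
  have IQ : Integrable Q := by
    have hC₂0 : 0 ≤ C₂ * ‖a‖ * ‖b‖ * d ^ (-(3 : ℝ)) := by
      have h := hC₂ a b (EuclideanSpace.single 0 1)
      have hn : ‖(EuclideanSpace.single 0 1 : ℝ³)‖ = 1 := by simp
      rw [hn, Real.one_rpow, mul_one] at h
      have : 0 ≤ C₂ * ‖a‖ * ‖b‖ := (abs_nonneg _).trans h
      exact mul_nonneg this (Real.rpow_nonneg hd.le _)
    have hmeas : AEStronglyMeasurable Q volume :=
      (hχc.measurable.mul (measurable_newtonNearHess r₀ r₁ a b)).aestronglyMeasurable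
    have hmaj : Integrable ((closedBall (0 : ℝ³) r₁).indicator
        fun _ : ℝ³ => C₂ * ‖a‖ * ‖b‖ * d ^ (-(3 : ℝ))) :=
      (integrableOn_const (measure_closedBall_lt_top (x := (0 : ℝ³)) (r := r₁)).ne).integrable_indicator
        measurableSet_closedBall
    refine hmaj.mono' hmeas (Eventually.of_forall fun z => ?_)
    rw [Real.norm_eq_abs]
    by_cases hz : z ∈ closedBall (0 : ℝ³) r₁
    · rw [indicator_of_mem hz, hQ]
      simp only
      rw [abs_mul]
      by_cases hχz : χ z = 0
      · rw [hχz, abs_zero, zero_mul]; exact hC₂0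
      · have hz2 : 2 * d ≤ ‖z + w‖ := by
          by_contra h
          exact hχz ((truncation_eventuallyEq_zero hd (not_le.1 h)).eq_of_nhds)
        have hzd : d ≤ ‖z‖ := by
          have := norm_add_le z w
          linarith
        calc |χ z| * |newtonNearHess r₀ r₁ a b z|
            ≤ 1 * (C₂ * ‖a‖ * ‖b‖ * ‖z‖ ^ (-(3 : ℝ))) :=
              mul_le_mul (hχ1 z) (hC₂ a b z) (abs_nonneg _) zero_le_one
          _ ≤ 1 * (C₂ * ‖a‖ * ‖b‖ * d ^ (-(3 : ℝ))) := by
              have hc : 0 ≤ C₂ * ‖a‖ * ‖b‖ := by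
                have := hC₂0
                by_contra hneg
                have hdpos : 0 < d ^ (-(3 : ℝ)) := Real.rpow_pos_of_pos hd _
                have : C₂ * ‖a‖ * ‖b‖ * d ^ (-(3 : ℝ)) < 0 :=
                  mul_neg_of_neg_of_pos (not_le.1 hneg) hdpos
                linarith
              refine mul_le_mul_of_nonneg_left (mul_le_mul_of_nonneg_left ?_ hc) zero_le_one
              exact Real.rpow_le_rpow_of_nonpos hd hzd (by norm_num)
          _ = C₂ * ‖a‖ * ‖b‖ * d ^ (-(3 : ℝ)) := one_mul _
    · rw [indicator_of_notMem hz, hQ]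
      simp only
      rw [newtonNearHess_eq_zero_of_le h₀ h₁ a b ?_, mul_zero, abs_zero]
      rw [mem_closedBall_zero_iff, not_le] at hz
      exact hz.le
  -- integration by parts: `∫ (P + Q) = ∫ ∂_b(χ ∂_aΓ₀) = 0`
  have hIBP : (∫ z, P z) + ∫ z, Q z = 0 := by
    rw [← integral_add IP IQ]
    have h0 := integral_fderiv_apply_eq_zero
      (contDiff_truncation_mul_newtonNearGrad h₀ h₁ hd hw a)
      (hasCompactSupport_truncation_mul_newtonNearGrad h₀ h₁ w d a) b
    rw [← h0]
    refine integral_congr_ae (Eventually.of_forall fun z => ?_)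
    exact (fderiv_truncation_mul_newtonNearGrad_apply hd hw a b z).symm
  have hQP : ∫ z, Q z = -∫ z, P z := by linarith
  show |∫ z, Q z| ≤ _
  rw [hQP, abs_neg]
  exact abs_integral_fderiv_truncation_mul_newtonNearGrad_le h₀ h₁ hd hw hM0 hM hC₁0 hC₁ a b

end Cancellation

end Literature.Analysis.FluidPDE
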